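import Summits.AtomisticToContinuum.Crystallization.Theses.ReggeStarCoercivity
import Literature.Barriers.AtomisticToContinuum.IcosahedralClusters

/-!
# Negative knowledge for crux `DefectFreeCrystallizes` — icosahedral shells are CHARGED by the
# 1/20-defect predicate, at every scale and orientation (the √2-gap)

Both admissible patterns of `ReggeStarCoercivity.ZeroDefectDensity` / `DefectFreeCrystallizes`
contain two points at distance `√2`; a `1/20`-matched shell therefore has a chord of length
`√2 ± 1/10` and radii within `1/20` of `1`. The regular icosahedron of circumradius `σ` has squared
chords only in `{1.1056, 2.894, 4}·σ²` (certified in a `ℤ[φ]` model by `decide`), hence is never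
`1/20`-close to either pattern (`not_shellCloseTo_ico_fcc`, `not_shellCloseTo_ico_hcp`).
Supports item stmt-AtomisticToContinuum-13603 (standing disprover, cycle 2).
-/

noncomputable section

namespace Summit.AtomisticToContinuum.Crystallization.Theorems.DefectFreeCrystallizes.Negative.IcosahedralShellsCharged

open Literature.Geometry.DiscreteGeometry

/-- `(a, b) ↦ a + b·φ`, `φ` the golden ratio. -/
def gold (x : ℤ × ℤ) : ℝ := x.1 + x.2 * Real.goldenRatio

/-- Multiplication in `ℤ[φ]` (`φ² = φ + 1`). -/
def gmul (x y : ℤ × ℤ) : ℤ × ℤ := (x.1 * y.1 + x.2 * y.2, x.1 * y.2 + x.2 * y.1 + x.2 * y.2)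

/-- `gold` is additive. [folklore] -/
theorem gold_add (x y : ℤ × ℤ) : gold (x + y) = gold x + gold y := by
  simp only [gold, Prod.fst_add, Prod.snd_add]; push_cast; ring

/-- `gold` respects subtraction. [folklore] -/
theorem gold_sub (x y : ℤ × ℤ) : gold (x - y) = gold x - gold y := by
  simp only [gold, Prod.fst_sub, Prod.snd_sub]; push_cast; ring

/-- `gold` is multiplicative for `gmul` (uses `φ² = φ + 1`). [folklore] -/
theorem gold_gmul (x y : ℤ × ℤ) : gold (gmul x y) = gold x * gold y := by
  simp only [gold, gmul]; push_cast
  linear_combination (-(x.2 : ℝ) * y.2) * Real.goldenRatio_sq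

/-- The real vector with `ℤ[φ]` coordinates `v`. -/
def gvec (v : Fin 3 → ℤ × ℤ) : EuclideanSpace ℝ (Fin 3) := WithLp.toLp 2 fun i => gold (v i)

/-- Squared norm in the `ℤ[φ]` model. -/
def gnormSq (v : Fin 3 → ℤ × ℤ) : ℤ × ℤ := gmul (v 0) (v 0) + gmul (v 1) (v 1) + gmul (v 2) (v 2)

/-- Coordinates of `gvec`. [folklore] -/
@[simp] theorem gvec_apply (v : Fin 3 → ℤ × ℤ) (i : Fin 3) : gvec v i = gold (v i) := rfl

/-- `gvec` respects subtraction. [folklore] -/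
theorem gvec_sub (v w : Fin 3 → ℤ × ℤ) : gvec v - gvec w = gvec (v - w) := by
  ext i; simp [gold_sub]

/-- Squared norm of `gvec v` is `gold (gnormSq v)`. [folklore] -/
theorem norm_gvec_sq (v : Fin 3 → ℤ × ℤ) : ‖gvec v‖ ^ 2 = gold (gnormSq v) := by
  rw [EuclideanSpace.norm_eq, Real.sq_sqrt (by positivity), Fin.sum_univ_three]
  simp only [gvec_apply, Real.norm_eq_abs, sq_abs, gnormSq, gold_add, gold_gmul]
  ring

/-- The twelve vertices `(0, ±1, ±φ)` (cyclic) of the regular icosahedron, in the `ℤ[φ]` model. -/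
def icoInt : Finset (Fin 3 → ℤ × ℤ) :=
  {![(0, 0), (1, 0), (0, 1)], ![(0, 0), (1, 0), (0, -1)], ![(0, 0), (-1, 0), (0, 1)], ![(0, 0), (-1, 0), (0, -1)],
   ![(1, 0), (0, 1), (0, 0)], ![(1, 0), (0, -1), (0, 0)], ![(-1, 0), (0, 1), (0, 0)], ![(-1, 0), (0, -1), (0, 0)],
   ![(0, 1), (0, 0), (1, 0)], ![(0, -1), (0, 0), (1, 0)], ![(0, 1), (0, 0), (-1, 0)], ![(0, -1), (0, 0), (-1, 0)]}

/-- All vertices have squared norm `2 + φ`. -/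
theorem gnormSq_icoInt : ∀ v ∈ icoInt, gnormSq v = (2, 1) := by decide

/-- Squared chords of the icosahedron: `4`, `4 + 4φ` or `8 + 4φ` (edge, long chord, diameter). -/
theorem gnormSq_sub_icoInt : ∀ v ∈ icoInt, ∀ w ∈ icoInt, v ≠ w →
    gnormSq (v - w) = (4, 0) ∨ gnormSq (v - w) = (4, 4) ∨ gnormSq (v - w) = (8, 4) := by decide

/-- `3/2 < φ`. [folklore] -/
theorem three_halves_lt_goldenRatio : (3 : ℝ) / 2 < Real.goldenRatio := by
  have h5 : (2 : ℝ) < Real.sqrt 5 := by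
    rw [show (2 : ℝ) = Real.sqrt 4 by rw [show (4 : ℝ) = 2 ^ 2 by norm_num, Real.sqrt_sq (by norm_num)]]
    exact Real.sqrt_lt_sqrt (by norm_num) (by norm_num)
  simp only [Real.goldenRatio]; linarith

/-- **The √2-gap lemma.** A shell all of whose points have norm `σ` and all of whose squared chords
avoid the window `(6σ²/5, 13σ²/5)` is not `1/20`-matched to any isometric image of a pattern of
unit vectors containing two points at distance `√2`. [folklore] -/
theorem not_etaMatched_of_gap {T P : Finset (EuclideanSpace ℝ (Fin 3))} {σ : ℝ} {A : EuclideanSpace ℝ (Fin 3) →ₗᵢ[ℝ] EuclideanSpace ℝ (Fin 3)}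
    (hP1 : ∀ p ∈ P, ‖p‖ = 1) (hP2 : ∃ p ∈ P, ∃ q ∈ P, ‖p - q‖ ^ 2 = 2)
    (hσ : ∀ t ∈ T, ‖t‖ = σ)
    (hgap : ∀ t ∈ T, ∀ t' ∈ T, t ≠ t' → ‖t - t'‖ ^ 2 ≤ 6 / 5 * σ ^ 2 ∨ 13 / 5 * σ ^ 2 ≤ ‖t - t'‖ ^ 2) :
    ¬ EtaMatched (1 / 20) T (P.image A) := by
  rintro ⟨e, he⟩
  obtain ⟨p, hp, q, hq, hpq⟩ := hP2
  have hpq_ne : p ≠ q := by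
    intro h; rw [h, sub_self, norm_zero] at hpq; norm_num at hpq
  have hpA : A p ∈ P.image A := Finset.mem_image_of_mem _ hp
  have hqA : A q ∈ P.image A := Finset.mem_image_of_mem _ hq
  -- the two matched shell points
  have htp_mem : ((e.symm ⟨A p, hpA⟩ : T) : EuclideanSpace ℝ (Fin 3)) ∈ T := (e.symm ⟨A p, hpA⟩).2
  have htq_mem : ((e.symm ⟨A q, hqA⟩ : T) : EuclideanSpace ℝ (Fin 3)) ∈ T := (e.symm ⟨A q, hqA⟩).2
  have hne : ((e.symm ⟨A p, hpA⟩ : T) : EuclideanSpace ℝ (Fin 3)) ≠ ((e.symm ⟨A q, hqA⟩ : T) : EuclideanSpace ℝ (Fin 3)) := by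
    intro h
    have h1 : e.symm ⟨A p, hpA⟩ = e.symm ⟨A q, hqA⟩ := Subtype.ext h
    have h2 := congrArg Subtype.val (e.symm.injective h1)
    exact hpq_ne (A.injective h2)
  have hdp : dist ((e.symm ⟨A p, hpA⟩ : T) : EuclideanSpace ℝ (Fin 3)) (A p) ≤ 1 / 20 := by
    have := he (e.symm ⟨A p, hpA⟩); rwa [Equiv.apply_symm_apply] at this
  have hdq : dist ((e.symm ⟨A q, hqA⟩ : T) : EuclideanSpace ℝ (Fin 3)) (A q) ≤ 1 / 20 := by
    have := he (e.symm ⟨A q, hqA⟩); rwa [Equiv.apply_symm_apply] at this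
  generalize ((e.symm ⟨A p, hpA⟩ : T) : EuclideanSpace ℝ (Fin 3)) = u at htp_mem hne hdp
  generalize ((e.symm ⟨A q, hqA⟩ : T) : EuclideanSpace ℝ (Fin 3)) = w at htq_mem hne hdq
  rw [dist_eq_norm] at hdp hdq
  -- radial pinning of σ
  have hσu : ‖u‖ = σ := hσ u htp_mem
  have hAp : ‖A p‖ = 1 := by rw [A.norm_map, hP1 p hp]
  have hrad : |σ - 1| ≤ 1 / 20 := by
    have := (abs_norm_sub_norm_le u (A p)).trans hdp
    rwa [hσu, hAp] at this
  -- the chord `u - w` is within `1/10` of the diagonal `A p - A q` of length `√2`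
  set d : ℝ := ‖A p - A q‖ with hd
  have hd2 : d ^ 2 = 2 := by rw [hd, ← map_sub, A.norm_map, hpq]
  have hd0 : 0 ≤ d := norm_nonneg _
  have hdlo : (141 : ℝ) / 100 < d := by nlinarith
  have hdhi : d < (1415 : ℝ) / 1000 := by nlinarith
  set D : ℝ := ‖u - w‖ with hD
  have hD0 : 0 ≤ D := norm_nonneg _
  have hDd : |D - d| ≤ 1 / 10 := by
    have h1 : |D - d| ≤ ‖(u - w) - (A p - A q)‖ := abs_norm_sub_norm_le _ _
    have h2 : ‖(u - w) - (A p - A q)‖ ≤ ‖u - A p‖ + ‖w - A q‖ := by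
      calc ‖(u - w) - (A p - A q)‖ = ‖(u - A p) - (w - A q)‖ := by abel_nf
        _ ≤ ‖u - A p‖ + ‖w - A q‖ := norm_sub_le _ _
    linarith
  rw [abs_le] at hrad hDd
  rcases hgap u htp_mem w htq_mem hne with h | h
  · -- short chord: D² ≤ 1.2 σ² ≤ 1.323, but D ≥ 1.31
    have hσ2 : σ ^ 2 ≤ (21 / 20) ^ 2 := by nlinarith
    nlinarith
  · -- long chord: D² ≥ 2.6 σ² ≥ 2.346, but D ≤ 1.5143
    have hσ2 : (19 / 20 : ℝ) ^ 2 ≤ σ ^ 2 := by nlinarith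
    nlinarith

/-- Squared distance of two points of a scaled integer pattern. [folklore] -/
theorem norm_sub_sq_scaledPattern {N : ℕ} (hN : N ≠ 0) (v w : Fin 3 → ℤ) :
    ‖((Real.sqrt N)⁻¹ • intVec v : EuclideanSpace ℝ (Fin 3)) - (Real.sqrt N)⁻¹ • intVec w‖ ^ 2 = (sqNormInt (v - w) : ℝ) / N := by
  have hpos : (0 : ℝ) < Real.sqrt N := by positivity
  rw [← smul_sub, intVec_sub, norm_smul, norm_inv, Real.norm_of_nonneg hpos.le, norm_intVec, mul_pow,
    inv_pow, Real.sq_sqrt (by positivity), Real.sq_sqrt (Literature.Barriers.AtomisticToContinuum.sqNormInt_nonneg _)]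
  ring

/-- The fcc pattern has a square diagonal: two points at distance `√2`. [folklore] -/
theorem exists_sq_dist_two_fcc : ∃ p ∈ fccKissingPattern, ∃ q ∈ fccKissingPattern, ‖p - q‖ ^ 2 = 2 := by
  refine ⟨_, Finset.mem_image_of_mem _ (show ![1, 1, 0] ∈ fccInt by decide), _,
    Finset.mem_image_of_mem _ (show ![1, -1, 0] ∈ fccInt by decide), ?_⟩
  rw [norm_sub_sq_scaledPattern two_ne_zero]
  have : sqNormInt (![1, 1, 0] - ![1, -1, 0]) = 4 := by decide
  rw [this]; norm_num

/-- The hcp pattern has a square diagonal too. [folklore] -/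
theorem exists_sq_dist_two_hcp : ∃ p ∈ hcpKissingPattern, ∃ q ∈ hcpKissingPattern, ‖p - q‖ ^ 2 = 2 := by
  refine ⟨_, Finset.mem_image_of_mem _ (show ![3, 3, 0] ∈ hcpInt by decide), _,
    Finset.mem_image_of_mem _ (show ![3, -3, 0] ∈ hcpInt by decide), ?_⟩
  rw [norm_sub_sq_scaledPattern (by norm_num)]
  have : sqNormInt (![3, 3, 0] - ![3, -3, 0]) = 36 := by decide
  rw [this]; norm_num

/-- An icosahedral shell of any size `c > 0` and orientation `B` satisfies the hypotheses of the
√2-gap lemma with `σ² = c² (2 + φ)`. -/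
theorem ico_shell_gap (B : EuclideanSpace ℝ (Fin 3) →ₗᵢ[ℝ] EuclideanSpace ℝ (Fin 3)) {c : ℝ} (hc : 0 < c) :
    (∀ t ∈ icoInt.image (fun v => B (c • gvec v)), ‖t‖ = c * Real.sqrt (2 + Real.goldenRatio)) ∧
    (∀ t ∈ icoInt.image (fun v => B (c • gvec v)), ∀ t' ∈ icoInt.image (fun v => B (c • gvec v)),
      t ≠ t' → ‖t - t'‖ ^ 2 ≤ 6 / 5 * (c * Real.sqrt (2 + Real.goldenRatio)) ^ 2 ∨
        13 / 5 * (c * Real.sqrt (2 + Real.goldenRatio)) ^ 2 ≤ ‖t - t'‖ ^ 2) := by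
  have hφ := three_halves_lt_goldenRatio
  have hφ0 : (0 : ℝ) ≤ 2 + Real.goldenRatio := by linarith
  constructor
  · intro t ht
    obtain ⟨v, hv, rfl⟩ := Finset.mem_image.1 ht
    have h2 : ‖gvec v‖ ^ 2 = 2 + Real.goldenRatio := by
      rw [norm_gvec_sq, gnormSq_icoInt v hv]; simp [gold]
    have h3 : ‖gvec v‖ = Real.sqrt (2 + Real.goldenRatio) := by
      rw [← h2, Real.sqrt_sq (norm_nonneg _)]
    rw [B.norm_map, norm_smul, Real.norm_of_nonneg hc.le, h3]
  · intro t ht t' ht' hne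
    obtain ⟨v, hv, rfl⟩ := Finset.mem_image.1 ht
    obtain ⟨w, hw, rfl⟩ := Finset.mem_image.1 ht'
    have hvw : v ≠ w := fun h => hne (by rw [h])
    have hsq : ‖B (c • gvec v) - B (c • gvec w)‖ ^ 2 = c ^ 2 * gold (gnormSq (v - w)) := by
      rw [← map_sub, B.norm_map, ← smul_sub, norm_smul, Real.norm_of_nonneg hc.le, mul_pow, gvec_sub,
        norm_gvec_sq]
    rw [hsq, mul_pow, Real.sq_sqrt hφ0]
    have hc2 : 0 < c ^ 2 := by positivity
    rcases gnormSq_sub_icoInt v hv w hw hvw with h | h | h <;> rw [h] <;> simp only [gold] <;> push_cast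
    · left; nlinarith
    · right; nlinarith
    · right; nlinarith

/-- **Icosahedral shells are not fcc-close**, at any size and orientation. [folklore] -/
theorem not_shellCloseTo_ico_fcc (B : EuclideanSpace ℝ (Fin 3) →ₗᵢ[ℝ] EuclideanSpace ℝ (Fin 3)) {c : ℝ} (hc : 0 < c) :
    ¬ ShellCloseTo (1 / 20) (icoInt.image fun v => B (c • gvec v)) fccKissingPattern := by
  rintro ⟨A, hA⟩
  obtain ⟨h1, h2⟩ := ico_shell_gap B hc
  exact not_etaMatched_of_gap (fun p hp => norm_eq_one_of_mem_fccKissingPattern hp)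
    exists_sq_dist_two_fcc h1 h2 hA

/-- **Icosahedral shells are not hcp-close**, at any size and orientation. [folklore] -/
theorem not_shellCloseTo_ico_hcp (B : EuclideanSpace ℝ (Fin 3) →ₗᵢ[ℝ] EuclideanSpace ℝ (Fin 3)) {c : ℝ} (hc : 0 < c) :
    ¬ ShellCloseTo (1 / 20) (icoInt.image fun v => B (c • gvec v)) hcpKissingPattern := by
  rintro ⟨A, hA⟩
  obtain ⟨h1, h2⟩ := ico_shell_gap B hc
  exact not_etaMatched_of_gap (fun p hp => norm_eq_one_of_mem_hcpKissingPattern hp)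
    exists_sq_dist_two_hcp h1 h2 hA


end Summit.AtomisticToContinuum.Crystallization.Theorems.DefectFreeCrystallizes.Negative.IcosahedralShellsCharged

end
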